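import Summits.AtomisticToContinuum.FouriersLaw.Theses.PuiseuxTransferLedger

/-!
# `SeriesLedgerGlue` — the series-ledger glue step of route `PuiseuxTransferLedger`

Item `stmt-AtomisticToContinuum-12113` (support, shared with `stmt-AtomisticToContinuum-4406`).
Pure real analysis: for a positive sequence `D N` (`N ≥ 2`) whose series ledger
`R_N := (N-1)/D_N` satisfies `|R_N - 2/γ - (N-1)·r| ≤ B`, the non-ballistic property forces
`r > 0`, and then `D_N → 1/r`.
-/

namespace Summit.AtomisticToContinuum.FouriersLaw.Theorems

open Filter Topology

/-- **SeriesLedgerGlue** (item `stmt-AtomisticToContinuum-12113`, route `PuiseuxTransferLedger`):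
for a real sequence `D` with `D N > 0` (`N ≥ 2`), `γ > 0`, and
`|(N-1)/D N - 2/γ - (N-1)·r| ≤ B` for all `N ≥ 2`, the non-ballistic property
`∀ ε > 0, ∀ N₀, ∃ N ≥ N₀, D N ≤ ε·(N-1)` forces `0 < r` and `D N → 1/r`.
Proof: `B ≥ 0` (from `N = 2`) and `K := 2/γ + B > 0`; if `r ≤ 0` the ledger gives
`(N-1)/D N ≤ K`, i.e. `D N ≥ (N-1)/K`, contradicting non-ballisticity at `ε = 1/(2K)`;
hence `r > 0`, then `|1/D N - r| ≤ K/(N-1) → 0` and `D N = (1/D N)⁻¹ → r⁻¹ = 1/r`. -/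
theorem seriesLedgerGlue_proof :
    Summit.AtomisticToContinuum.FouriersLaw.Theses.PuiseuxTransferLedger.SeriesLedgerGlue := by
  unfold Summit.AtomisticToContinuum.FouriersLaw.Theses.PuiseuxTransferLedger.SeriesLedgerGlue
  intro D γ r B hγ hD hL hNB
  -- Step 0: `B ≥ 0` and `K := 2/γ + B > 0`.
  have hB : 0 ≤ B := le_trans (abs_nonneg _) (hL 2 le_rfl)
  have hγ' : 0 < 2 / γ := div_pos two_pos hγ
  obtain ⟨K, hK_def⟩ : ∃ K : ℝ, K = 2 / γ + B := ⟨_, rfl⟩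
  have hK : 0 < K := by rw [hK_def]; exact add_pos_of_pos_of_nonneg hγ' hB
  have hKne : K ≠ 0 := ne_of_gt hK
  -- cast facts for `N ≥ 2`
  have hN1 : ∀ N : ℕ, 2 ≤ N → (1 : ℝ) ≤ (N : ℝ) - 1 := by
    intro N hN
    have h2 : (2 : ℝ) ≤ (N : ℝ) := by exact_mod_cast hN
    linarith
  -- Step 1: the ledger without the contact constant: `|(N-1)/D N - (N-1) r| ≤ K`.
  have hL' : ∀ N : ℕ, 2 ≤ N → |((N : ℝ) - 1) / D N - ((N : ℝ) - 1) * r| ≤ K := by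
    intro N hN
    have h1 := abs_le.mp (hL N hN)
    rw [abs_le]
    constructor
    · linarith [h1.1]
    · linarith [h1.2]
  -- Step 2: `0 < r`.
  have hr : 0 < r := by
    by_contra hr0
    have hr : r ≤ 0 := not_lt.mp hr0
    -- for `N ≥ 2`: `D N ≥ (N-1)/K`
    have hlow : ∀ N : ℕ, 2 ≤ N → ((N : ℝ) - 1) / K ≤ D N := by
      intro N hN
      have hDN := hD N hN
      have hN0 : (0 : ℝ) ≤ (N : ℝ) - 1 := le_trans zero_le_one (hN1 N hN)
      have h := (abs_le.mp (hL' N hN)).2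
      have hmul : ((N : ℝ) - 1) * r ≤ 0 := mul_nonpos_of_nonneg_of_nonpos hN0 hr
      have hRle : ((N : ℝ) - 1) / D N ≤ K := by linarith
      rw [div_le_iff₀ hDN] at hRle
      rw [div_le_iff₀ hK]
      linarith [mul_comm K (D N)]
    obtain ⟨N, hN, hDle⟩ := hNB (1 / (2 * K)) (by positivity) 2
    have h1 := hlow N hN
    have h3 : ((N : ℝ) - 1) / K ≤ 1 / (2 * K) * ((N : ℝ) - 1) := le_trans h1 hDle
    have h2 : 1 / (2 * K) * ((N : ℝ) - 1) = ((N : ℝ) - 1) / K / 2 := by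
      field_simp
    rw [h2] at h3
    have h4 : 0 < ((N : ℝ) - 1) / K := div_pos (lt_of_lt_of_le zero_lt_one (hN1 N hN)) hK
    linarith
  refine ⟨hr, ?_⟩
  -- Step 3: `1 / D N → r`.
  have hinv : Tendsto (fun N : ℕ => 1 / D N) atTop (𝓝 r) := by
    have hbound : ∀ N : ℕ, 2 ≤ N → |1 / D N - r| ≤ K / ((N : ℝ) - 1) := by
      intro N hN
      have hNpos : (0 : ℝ) < (N : ℝ) - 1 := lt_of_lt_of_le zero_lt_one (hN1 N hN)
      have h := hL' N hN
      have h3 : ((N : ℝ) - 1) / D N - ((N : ℝ) - 1) * r = ((N : ℝ) - 1) * (1 / D N - r) := by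
        ring
      rw [h3, abs_mul, abs_of_pos hNpos] at h
      rw [le_div_iff₀ hNpos]
      linarith [mul_comm ((N : ℝ) - 1) (|1 / D N - r|)]
    have hK0 : Tendsto (fun N : ℕ => K / ((N : ℝ) - 1)) atTop (𝓝 0) := by
      have hden : Tendsto (fun N : ℕ => (N : ℝ) - 1) atTop atTop := by
        have := tendsto_atTop_add_const_right atTop (-1 : ℝ) tendsto_natCast_atTop_atTop
        simpa [sub_eq_add_neg] using this
      exact tendsto_const_nhds.div_atTop hden
    have h0 : Tendsto (fun N : ℕ => 1 / D N - r) atTop (𝓝 0) := by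
      refine squeeze_zero_norm' ?_ hK0
      filter_upwards [eventually_ge_atTop 2] with N hN
      rw [Real.norm_eq_abs]
      exact hbound N hN
    have h5 := h0.add_const r
    simpa using h5
  -- Step 4: invert.
  have h : Tendsto (fun N : ℕ => (1 / D N)⁻¹) atTop (𝓝 r⁻¹) := hinv.inv₀ (ne_of_gt hr)
  have hD_eq : (fun N : ℕ => (1 / D N)⁻¹) = D := by
    funext N
    rw [one_div, inv_inv]
  rw [hD_eq, ← one_div] at h
  exact h

end Summit.AtomisticToContinuum.FouriersLaw.Theorems
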